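import Summits.BirchSwinnertonDyer.BirchSwinnertonDyer.Theorems.ClassRecordThreeRegCertKernelYFree
import Summits.BirchSwinnertonDyer.BirchSwinnertonDyer.Theorems.ClassRecordThreeRegCertKernelUniform
import HarnessLib

/-!
# Route `ClassRecordThree`, crux `SchneiderAtThree` (item 19106): the `y`-FREE REG3CERT certificate wrappers — first,
# second, third order (`v₃(e(Q)) = 1`) and the uniform deep checker (`v₃(e(Q)) ≥ 2`) from the `x`-coordinate alone
# (cell `bsd-stepL`, seat `bsd-stepL-reg3-eng` g4; `--supports stmt-BirchSwinnertonDyer-19106`)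

HONEST FRAMING: BSD is not proved by any of this; nothing here closes the crux; Schneider's non-degeneracy conjecture
(barrier `PAdicHeightNondegeneracy`) is asserted NOWHERE; every application is ONE curve. Each wrapper below is the
`y`-free twin of a landed checker (`certNonsplit_of_residueCert`, `…O2`, `…O3`, `certNonsplit_of_uniformCert`): the bundled
integer hypothesis `H` names `a`, `e'` and the residues, but instead of `b` only a residue `β` of `b` modulo `3^M` together with
`IsSquare ((a₁ae + a₃e³)² + 4(a³ + a₂a²e² + a₄ae⁴ + a₆e⁶))`, the Hensel clauses `3^M ∣ β² + Pβ − R`, `3 ∤ 2β + P`, and the `y`-free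
reduction test of `…RegCertKernelYFree` §2. Conclusion: `∃ y, (x, y) ∈ W ∧ ∀ h, RegMult.CertNonsplit W 3 (x, y) 1` — consumed by
`rung_of_exists_cert`. Purpose: the five byte-capped REG3CERT rows (`e(Q)` with `48 914 … 72 331` digits). Every `H` is decided
per row by ONE `norm_num` (the square root of the `≈ 6·digits(e)`-digit discriminant lives only in the proof term).
Theorems only (0 defs, 0 facts). References: [SteinWuthrich2013] §4.2; [SilvermanAEC2009] III.1, VII.2.1, VII.3.4;
[MazurSteinTate2006] §1.
-/

open scoped Classical

open WeierstrassCurve Literature.NumberTheory.EllipticCurves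
  Literature.NumberTheory.EllipticCurves.Rank1Residual
  Literature.NumberTheory.EllipticCurves.SteinWuthrich2013
  Summit.BirchSwinnertonDyer.Rank1Residual
  Summit.BirchSwinnertonDyer.Rank1Residual.X11b

namespace Summit.BirchSwinnertonDyer.Rank1Residual.X11b.RegMult.KernelCert

/-- `3 ∤ b` and `3^M ∣ c·(b − β)`-type transport: if `3^M ∣ b − β` (`M ≥ 1`) and `3 ∤ β` then `3 ∤ b`. [folklore] -/
private theorem not_three_dvd_of_dvd_sub {b β : ℤ} {M : ℕ} (hM : 1 ≤ M) (h : (3 : ℤ) ^ M ∣ b - β) (h3β : ¬ (3 : ℤ) ∣ β) :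
    ¬ (3 : ℤ) ∣ b := by
  intro h3b
  have h1 : (3 : ℤ) ∣ b - β := (dvd_pow_self 3 (by omega)).trans h
  have : (3 : ℤ) ∣ b - (b - β) := dvd_sub h3b h1
  rw [sub_sub_cancel] at this
  exact h3β this

/-- Transport of a linear congruence along `3^M ∣ b − β`: `3^M ∣ t + ζβ ⇒ 3^M ∣ t + ζb`. [folklore] -/
private theorem dvd_add_mul_of_dvd_sub {t ζ b β : ℤ} {M : ℕ} (h : (3 : ℤ) ^ M ∣ b - β) (hβ : (3 : ℤ) ^ M ∣ t + ζ * β) :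
    (3 : ℤ) ^ M ∣ t + ζ * b := by
  have : t + ζ * b = (t + ζ * β) + ζ * (b - β) := by ring
  rw [this]; exact dvd_add hβ (h.mul_left ζ)

/-! ### §1 First order (`v₃(e) = 1`, `v₃(h) = 1`), `y`-free -/

/-- **`y`-free first-order REG3CERT certificate** (twin of `certNonsplit_of_residueCert`): `H` = the row's integer facts with
`b` replaced by its residue `β (mod 81)` (`3 ∤ β`, `81 ∣ a·3e' + ζβ`), plus `IsSquare (P² + 4R)`, `81 ∣ β² + Pβ − R`, `3 ∤ 2β + P`
(`P = a₁a·3e' + a₃(3e')³`, `R = a³ + a₂a²(3e')² + a₄a(3e')⁴ + a₆(3e')⁶`), the `y`-free reduction test and its parity clause.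
Conclusion: some `y` with `(x, y) ∈ W` carries `RegMult.CertNonsplit W 3 (x, y) 1`. Per curve; nothing class-wide.
[cite: SteinWuthrich2013, §4.2] [cite: SilvermanAEC2009, VII.3.4] -/
theorem exists_certNonsplit_of_residueCert_yfree (W : WeierstrassCurve ℚ) {a₁ a₂ a₃ a₄ a₆ : ℤ}
    (hW : W = ⟨a₁, a₂, a₃, a₄, a₆⟩) [W.IsElliptic] [W.IsGloballyMinimal] {a β c4 c6 γ ζ ℓ ω κ u : ℤ} {e' n : ℕ}
    (H : c4 = (a₁ ^ 2 + 4 * a₂) ^ 2 - 24 * (2 * a₄ + a₁ * a₃) ∧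
      c6 = -(a₁ ^ 2 + 4 * a₂) ^ 3 + 36 * (a₁ ^ 2 + 4 * a₂) * (2 * a₄ + a₁ * a₃) - 216 * (a₃ ^ 2 + 4 * a₆) ∧
      ¬ (3 : ℤ) ∣ c6 ∧ ¬ (3 : ℤ) ∣ e' ∧ ¬ (3 : ℤ) ∣ β ∧ Nat.Coprime a.natAbs (3 * e') ∧
      IsSquare ((a₁ * a * (3 * e' : ℕ) + a₃ * (3 * e' : ℕ) ^ 3) ^ 2 +
        4 * (a ^ 3 + a₂ * a ^ 2 * (3 * e' : ℕ) ^ 2 + a₄ * a * (3 * e' : ℕ) ^ 4 + a₆ * (3 * e' : ℕ) ^ 6)) ∧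
      (3 : ℤ) ^ 4 ∣ β ^ 2 + (a₁ * a * (3 * e' : ℕ) + a₃ * (3 * e' : ℕ) ^ 3) * β -
        (a ^ 3 + a₂ * a ^ 2 * (3 * e' : ℕ) ^ 2 + a₄ * a * (3 * e' : ℕ) ^ 4 + a₆ * (3 * e' : ℕ) ^ 6) ∧
      ¬ (3 : ℤ) ∣ 2 * β + (a₁ * a * (3 * e' : ℕ) + a₃ * (3 * e' : ℕ) ^ 3) ∧
      Int.gcd ((a₁ * a * (3 * e' : ℕ) + a₃ * (3 * e' : ℕ) ^ 3) ^ 2 +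
          4 * (a ^ 3 + a₂ * a ^ 2 * (3 * e' : ℕ) ^ 2 + a₄ * a * (3 * e' : ℕ) ^ 4 + a₆ * (3 * e' : ℕ) ^ 6))
        (a₁ * (3 * e' : ℕ) * (a₁ * a * (3 * e' : ℕ) + a₃ * (3 * e' : ℕ) ^ 3) +
          2 * (3 * a ^ 2 + 2 * a₂ * a * (3 * e' : ℕ) ^ 2 + a₄ * (3 * e' : ℕ) ^ 4)) ∣ (2 * (3 * e')) ^ n ∧
      (¬ (2 : ℤ) ∣ a₁ * a * (3 * e' : ℕ) + a₃ * (3 * e' : ℕ) ^ 3 ∨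
        ¬ (2 : ℤ) ∣ a₁ * (3 * e' : ℕ) * (a ^ 3 + a₂ * a ^ 2 * (3 * e' : ℕ) ^ 2 + a₄ * a * (3 * e' : ℕ) ^ 4 + a₆ * (3 * e' : ℕ) ^ 6) -
          (3 * a ^ 2 + 2 * a₂ * a * (3 * e' : ℕ) ^ 2 + a₄ * (3 * e' : ℕ) ^ 4)) ∧
      (9 : ℤ) ∣ c4 + γ * c6 ∧ ¬ (3 : ℤ) ∣ γ ∧ (81 : ℤ) ∣ a * (3 * e' : ℕ) + ζ * β ∧
      (243 : ℤ) ∣ 6 * ζ + 3 * a₁ * ζ ^ 2 + 2 * (a₁ ^ 2 + a₂) * ζ ^ 3 - 6 * ℓ ∧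
      (9 : ℤ) ∣ ω ∧ (81 : ℤ) ∣ ℓ ^ 2 - ω * γ ∧ (9 : ℤ) ∣ κ ∧ (243 : ℤ) ∣ ω ^ 2 + 12 * ω - 24 * κ ∧
      9 * u = 2 * γ * κ ∧ ¬ (3 : ℤ) ∣ u ∧ ¬ (9 : ℤ) ∣ (e' : ℤ) ^ 4 - u ^ 2)
    {x : ℚ} (hx : x = a / ((3 * e' : ℕ) : ℚ) ^ 2) :
    ∃ y : ℚ, W.toAffine.Equation x y ∧ ∀ h : W.toAffine.Nonsingular x y, RegMult.CertNonsplit W 3 (.some x y h) 1 := by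
  obtain ⟨hc4, hc6, h3c6, h3e', h3β, hcop, hsq, hβ, h3P, hgcd, h2, hγ, h3γ, hζβ, hℓ, hω9, hω, hκ9, hκ, hu, h3u, hcert⟩ := H
  have he'0 : e' ≠ 0 := by rintro rfl; exact h3e' (by simp)
  have he0 : (3 * e' : ℕ) ≠ 0 := by positivity
  obtain ⟨b, hb, hbβ⟩ := exists_root_dvd_sub_of_isSquare hsq hβ h3P
  have h3b : ¬ (3 : ℤ) ∣ b := not_three_dvd_of_dvd_sub (by norm_num) hbβ h3β
  have hζ : (81 : ℤ) ∣ a * (3 * e' : ℕ) + ζ * b := by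
    have h81 : (81 : ℤ) = 3 ^ 4 := by norm_num
    rw [h81] at hζβ ⊢; exact dvd_add_mul_of_dvd_sub hbβ hζβ
  set y : ℚ := (b : ℚ) / ((3 * e' : ℕ) : ℚ) ^ 3 with hy
  refine ⟨y, ?_, fun h => ?_⟩
  · rw [hx, hy]; exact equation_of_intRoot W hW he0 hb
  · refine ⟨?_, fun q _ hq1 _ => ?_⟩
    · rw [one_smul]
      exact isAdmissible_of_yfree W hW he0 (dvd_mul_right 3 e') hcop hb hgcd h2 hx hy h
    · rw [one_smul]
      exact heightFourOneCoord_ne_zero_of_residueCert W (baseChange_a₁_eq W hW) (baseChange_a₂_eq W hW)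
        (baseChange_c₄_eq W hW hc4) (baseChange_c₆_eq W hW hc6) h3c6 h3e' h3b hcop hx hy hγ h3γ hζ hℓ hω9 hω hκ9 hκ hu
        h3u hcert hq1

/-! ### §2 Second order (`v₃(e) = 1`, `v₃(h) = 2`), `y`-free -/

/-- **`y`-free second-order REG3CERT certificate** (twin of `certNonsplit_of_residueCertO2`): as §1 with `Δ`, `3 ∤ c₄`,
`3 ∣ Δ`, the second-order residues (`γ mod 27`, `ω`, `κ mod 3⁵`) and certificate, `b` replaced by `β (mod 81)`.
Per curve; nothing class-wide. [cite: SteinWuthrich2013, §4.2] [cite: SilvermanAEC2009, VII.3.4] -/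
theorem exists_certNonsplit_of_residueCertO2_yfree (W : WeierstrassCurve ℚ) {a₁ a₂ a₃ a₄ a₆ : ℤ}
    (hW : W = ⟨a₁, a₂, a₃, a₄, a₆⟩) [W.IsElliptic] [W.IsGloballyMinimal] {a β c4 c6 D γ ζ ℓ ω κ u : ℤ} {e' n : ℕ}
    (H : c4 = (a₁ ^ 2 + 4 * a₂) ^ 2 - 24 * (2 * a₄ + a₁ * a₃) ∧
      c6 = -(a₁ ^ 2 + 4 * a₂) ^ 3 + 36 * (a₁ ^ 2 + 4 * a₂) * (2 * a₄ + a₁ * a₃) - 216 * (a₃ ^ 2 + 4 * a₆) ∧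
      D = -(a₁ ^ 2 + 4 * a₂) ^ 2 * (a₁ ^ 2 * a₆ + 4 * a₂ * a₆ - a₁ * a₃ * a₄ + a₂ * a₃ ^ 2 - a₄ ^ 2) -
        8 * (2 * a₄ + a₁ * a₃) ^ 3 - 27 * (a₃ ^ 2 + 4 * a₆) ^ 2 +
        9 * (a₁ ^ 2 + 4 * a₂) * (2 * a₄ + a₁ * a₃) * (a₃ ^ 2 + 4 * a₆) ∧
      ¬ (3 : ℤ) ∣ c4 ∧ ¬ (3 : ℤ) ∣ c6 ∧ (3 : ℤ) ∣ D ∧ ¬ (3 : ℤ) ∣ e' ∧ ¬ (3 : ℤ) ∣ β ∧ Nat.Coprime a.natAbs (3 * e') ∧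
      IsSquare ((a₁ * a * (3 * e' : ℕ) + a₃ * (3 * e' : ℕ) ^ 3) ^ 2 +
        4 * (a ^ 3 + a₂ * a ^ 2 * (3 * e' : ℕ) ^ 2 + a₄ * a * (3 * e' : ℕ) ^ 4 + a₆ * (3 * e' : ℕ) ^ 6)) ∧
      (3 : ℤ) ^ 4 ∣ β ^ 2 + (a₁ * a * (3 * e' : ℕ) + a₃ * (3 * e' : ℕ) ^ 3) * β -
        (a ^ 3 + a₂ * a ^ 2 * (3 * e' : ℕ) ^ 2 + a₄ * a * (3 * e' : ℕ) ^ 4 + a₆ * (3 * e' : ℕ) ^ 6) ∧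
      ¬ (3 : ℤ) ∣ 2 * β + (a₁ * a * (3 * e' : ℕ) + a₃ * (3 * e' : ℕ) ^ 3) ∧
      Int.gcd ((a₁ * a * (3 * e' : ℕ) + a₃ * (3 * e' : ℕ) ^ 3) ^ 2 +
          4 * (a ^ 3 + a₂ * a ^ 2 * (3 * e' : ℕ) ^ 2 + a₄ * a * (3 * e' : ℕ) ^ 4 + a₆ * (3 * e' : ℕ) ^ 6))
        (a₁ * (3 * e' : ℕ) * (a₁ * a * (3 * e' : ℕ) + a₃ * (3 * e' : ℕ) ^ 3) +
          2 * (3 * a ^ 2 + 2 * a₂ * a * (3 * e' : ℕ) ^ 2 + a₄ * (3 * e' : ℕ) ^ 4)) ∣ (2 * (3 * e')) ^ n ∧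
      (¬ (2 : ℤ) ∣ a₁ * a * (3 * e' : ℕ) + a₃ * (3 * e' : ℕ) ^ 3 ∨
        ¬ (2 : ℤ) ∣ a₁ * (3 * e' : ℕ) * (a ^ 3 + a₂ * a ^ 2 * (3 * e' : ℕ) ^ 2 + a₄ * a * (3 * e' : ℕ) ^ 4 + a₆ * (3 * e' : ℕ) ^ 6) -
          (3 * a ^ 2 + 2 * a₂ * a * (3 * e' : ℕ) ^ 2 + a₄ * (3 * e' : ℕ) ^ 4)) ∧
      (27 : ℤ) ∣ c4 * c4 ^ 3 + γ * c6 * (c4 ^ 3 + 240 * D) ∧ ¬ (3 : ℤ) ∣ γ ∧ (81 : ℤ) ∣ a * (3 * e' : ℕ) + ζ * β ∧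
      (243 : ℤ) ∣ 6 * ζ + 3 * a₁ * ζ ^ 2 + 2 * (a₁ ^ 2 + a₂) * ζ ^ 3 - 6 * ℓ ∧
      (9 : ℤ) ∣ ω ∧ (243 : ℤ) ∣ ℓ ^ 2 - ω * γ ∧ (9 : ℤ) ∣ κ ∧ (2187 : ℤ) ∣ 360 * ω + 30 * ω ^ 2 + ω ^ 3 - 720 * κ ∧
      9 * u = 2 * γ * κ ∧ ¬ (3 : ℤ) ∣ u ∧
      ¬ (81 : ℤ) ∣ 6 * ((e' : ℤ) ^ 4 - 1) - 3 * ((e' : ℤ) ^ 4 - 1) ^ 2 + 2 * ((e' : ℤ) ^ 4 - 1) ^ 3 -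
        6 * (u ^ 2 - 1) + 3 * (u ^ 2 - 1) ^ 2 - 2 * (u ^ 2 - 1) ^ 3)
    {x : ℚ} (hx : x = a / ((3 * e' : ℕ) : ℚ) ^ 2) :
    ∃ y : ℚ, W.toAffine.Equation x y ∧ ∀ h : W.toAffine.Nonsingular x y, RegMult.CertNonsplit W 3 (.some x y h) 1 := by
  obtain ⟨hc4, hc6, hD, h3c4, h3c6, h3D, h3e', h3β, hcop, hsq, hβ, h3P, hgcd, h2, hγ, h3γ, hζβ, hℓ, hω9, hω, hκ9, hκ, hu,
    h3u, hcert⟩ := H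
  have he'0 : e' ≠ 0 := by rintro rfl; exact h3e' (by simp)
  have he0 : (3 * e' : ℕ) ≠ 0 := by positivity
  obtain ⟨b, hb, hbβ⟩ := exists_root_dvd_sub_of_isSquare hsq hβ h3P
  have h3b : ¬ (3 : ℤ) ∣ b := not_three_dvd_of_dvd_sub (by norm_num) hbβ h3β
  have hζ : (81 : ℤ) ∣ a * (3 * e' : ℕ) + ζ * b := by
    have h81 : (81 : ℤ) = 3 ^ 4 := by norm_num
    rw [h81] at hζβ ⊢; exact dvd_add_mul_of_dvd_sub hbβ hζβ
  set y : ℚ := (b : ℚ) / ((3 * e' : ℕ) : ℚ) ^ 3 with hy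
  refine ⟨y, ?_, fun h => ?_⟩
  · rw [hx, hy]; exact equation_of_intRoot W hW he0 hb
  · refine ⟨?_, fun q _ hq1 hqj => ?_⟩
    · rw [one_smul]
      exact isAdmissible_of_yfree W hW he0 (dvd_mul_right 3 e') hcop hb hgcd h2 hx hy h
    · rw [one_smul]
      exact heightFourOneCoord_ne_zero_of_residueCertO2 W (baseChange_a₁_eq W hW) (baseChange_a₂_eq W hW)
        (baseChange_c₄_eq W hW hc4) (baseChange_c₆_eq W hW hc6) h3c4 h3c6 (ratCast_j_inv_eq W hW hc4 hD) h3D h3e' h3b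
        hcop hx hy hγ h3γ hζ hℓ hω9 hω hκ9 hκ hu h3u hcert hq1 hqj

/-! ### §3 Third order (`v₃(e) = 1`, `v₃(h) = 3`), `y`-free -/

/-- **`y`-free third-order REG3CERT certificate** (twin of `certNonsplit_of_residueCertO3`): as §2 with the third-order
residues (`r`, `γ mod 81`, `ζ mod 3⁵`, `ℓ`, `ω`, `κ`, `u`) and certificate, `b` replaced by `β (mod 3⁵)`.
Per curve; nothing class-wide. [cite: SteinWuthrich2013, §4.2] [cite: SilvermanAEC2009, VII.3.4] -/
theorem exists_certNonsplit_of_residueCertO3_yfree (W : WeierstrassCurve ℚ) {a₁ a₂ a₃ a₄ a₆ : ℤ}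
    (hW : W = ⟨a₁, a₂, a₃, a₄, a₆⟩) [W.IsElliptic] [W.IsGloballyMinimal] {a β c4 c6 D r γ ζ ℓ ω κ u : ℤ} {e' n : ℕ}
    (H : c4 = (a₁ ^ 2 + 4 * a₂) ^ 2 - 24 * (2 * a₄ + a₁ * a₃) ∧
      c6 = -(a₁ ^ 2 + 4 * a₂) ^ 3 + 36 * (a₁ ^ 2 + 4 * a₂) * (2 * a₄ + a₁ * a₃) - 216 * (a₃ ^ 2 + 4 * a₆) ∧
      D = -(a₁ ^ 2 + 4 * a₂) ^ 2 * (a₁ ^ 2 * a₆ + 4 * a₂ * a₆ - a₁ * a₃ * a₄ + a₂ * a₃ ^ 2 - a₄ ^ 2) -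
        8 * (2 * a₄ + a₁ * a₃) ^ 3 - 27 * (a₃ ^ 2 + 4 * a₆) ^ 2 +
        9 * (a₁ ^ 2 + 4 * a₂) * (2 * a₄ + a₁ * a₃) * (a₃ ^ 2 + 4 * a₆) ∧
      ¬ (3 : ℤ) ∣ c4 ∧ ¬ (3 : ℤ) ∣ c6 ∧ (3 : ℤ) ∣ D ∧ ¬ (3 : ℤ) ∣ e' ∧ ¬ (3 : ℤ) ∣ β ∧ Nat.Coprime a.natAbs (3 * e') ∧
      IsSquare ((a₁ * a * (3 * e' : ℕ) + a₃ * (3 * e' : ℕ) ^ 3) ^ 2 +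
        4 * (a ^ 3 + a₂ * a ^ 2 * (3 * e' : ℕ) ^ 2 + a₄ * a * (3 * e' : ℕ) ^ 4 + a₆ * (3 * e' : ℕ) ^ 6)) ∧
      (3 : ℤ) ^ 5 ∣ β ^ 2 + (a₁ * a * (3 * e' : ℕ) + a₃ * (3 * e' : ℕ) ^ 3) * β -
        (a ^ 3 + a₂ * a ^ 2 * (3 * e' : ℕ) ^ 2 + a₄ * a * (3 * e' : ℕ) ^ 4 + a₆ * (3 * e' : ℕ) ^ 6) ∧
      ¬ (3 : ℤ) ∣ 2 * β + (a₁ * a * (3 * e' : ℕ) + a₃ * (3 * e' : ℕ) ^ 3) ∧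
      Int.gcd ((a₁ * a * (3 * e' : ℕ) + a₃ * (3 * e' : ℕ) ^ 3) ^ 2 +
          4 * (a ^ 3 + a₂ * a ^ 2 * (3 * e' : ℕ) ^ 2 + a₄ * a * (3 * e' : ℕ) ^ 4 + a₆ * (3 * e' : ℕ) ^ 6))
        (a₁ * (3 * e' : ℕ) * (a₁ * a * (3 * e' : ℕ) + a₃ * (3 * e' : ℕ) ^ 3) +
          2 * (3 * a ^ 2 + 2 * a₂ * a * (3 * e' : ℕ) ^ 2 + a₄ * (3 * e' : ℕ) ^ 4)) ∣ (2 * (3 * e')) ^ n ∧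
      (¬ (2 : ℤ) ∣ a₁ * a * (3 * e' : ℕ) + a₃ * (3 * e' : ℕ) ^ 3 ∨
        ¬ (2 : ℤ) ∣ a₁ * (3 * e' : ℕ) * (a ^ 3 + a₂ * a ^ 2 * (3 * e' : ℕ) ^ 2 + a₄ * a * (3 * e' : ℕ) ^ 4 + a₆ * (3 * e' : ℕ) ^ 6) -
          (3 * a ^ 2 + 2 * a₂ * a * (3 * e' : ℕ) ^ 2 + a₄ * (3 * e' : ℕ) ^ 4)) ∧
      (9 : ℤ) ∣ D - r * c4 ^ 3 ∧
      (81 : ℤ) ∣ c4 * c4 ^ 3 * (c4 ^ 3 - 504 * D) + γ * c6 * ((c4 ^ 3) ^ 2 + 240 * D * c4 ^ 3 + 178560 * D ^ 2) ∧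
      ¬ (3 : ℤ) ∣ γ ∧ (243 : ℤ) ∣ a * (3 * e' : ℕ) + ζ * β ∧
      (729 : ℤ) ∣ 12 * ζ + 6 * a₁ * ζ ^ 2 + 4 * (a₁ ^ 2 + a₂) * ζ ^ 3 + 3 * (a₁ ^ 3 + 2 * a₁ * a₂ + 2 * a₃) * ζ ^ 4 -
        12 * ℓ ∧ (3 : ℤ) ∣ ℓ ∧
      (9 : ℤ) ∣ ω ∧ (729 : ℤ) ∣ ℓ ^ 2 - ω * γ ∧ (9 : ℤ) ∣ κ ∧ (6561 : ℤ) ∣ 360 * ω + 30 * ω ^ 2 + ω ^ 3 - 720 * κ ∧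
      9 * u = 2 * γ * κ * (1 - 4 * r * κ) ∧ ¬ (3 : ℤ) ∣ u ∧ (3 : ℤ) ∣ u ^ 2 - 1 ∧
      ¬ (243 : ℤ) ∣ 6 * ((e' : ℤ) ^ 4 - 1) - 3 * ((e' : ℤ) ^ 4 - 1) ^ 2 + 2 * ((e' : ℤ) ^ 4 - 1) ^ 3 -
        6 * (u ^ 2 - 1) + 3 * (u ^ 2 - 1) ^ 2 - 2 * (u ^ 2 - 1) ^ 3)
    {x : ℚ} (hx : x = a / ((3 * e' : ℕ) : ℚ) ^ 2) :
    ∃ y : ℚ, W.toAffine.Equation x y ∧ ∀ h : W.toAffine.Nonsingular x y, RegMult.CertNonsplit W 3 (.some x y h) 1 := by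
  obtain ⟨hc4, hc6, hD, h3c4, h3c6, h3D, h3e', h3β, hcop, hsq, hβ, h3P, hgcd, h2, hr, hγ, h3γ, hζβ, hℓ, h3ℓ, hω9, hω, hκ9,
    hκ, hu, h3u, h3u2, hcert⟩ := H
  have he'0 : e' ≠ 0 := by rintro rfl; exact h3e' (by simp)
  have he0 : (3 * e' : ℕ) ≠ 0 := by positivity
  obtain ⟨b, hb, hbβ⟩ := exists_root_dvd_sub_of_isSquare hsq hβ h3P
  have h3b : ¬ (3 : ℤ) ∣ b := not_three_dvd_of_dvd_sub (by norm_num) hbβ h3β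
  have hζ : (243 : ℤ) ∣ a * (3 * e' : ℕ) + ζ * b := by
    have h243 : (243 : ℤ) = 3 ^ 5 := by norm_num
    rw [h243] at hζβ ⊢; exact dvd_add_mul_of_dvd_sub hbβ hζβ
  set y : ℚ := (b : ℚ) / ((3 * e' : ℕ) : ℚ) ^ 3 with hy
  refine ⟨y, ?_, fun h => ?_⟩
  · rw [hx, hy]; exact equation_of_intRoot W hW he0 hb
  · refine ⟨?_, fun q _ hq1 hqj => ?_⟩
    · rw [one_smul]
      exact isAdmissible_of_yfree W hW he0 (dvd_mul_right 3 e') hcop hb hgcd h2 hx hy h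
    · rw [one_smul]
      exact heightFourOneCoord_ne_zero_of_residueCertO3 W (baseChange_a₁_eq W hW) (baseChange_a₂_eq W hW)
        (baseChange_a₃_eq W hW) (baseChange_c₄_eq W hW hc4) (baseChange_c₆_eq W hW hc6) h3c4 h3c6
        (ratCast_j_inv_eq W hW hc4 hD) h3D h3e' h3b hcop hx hy hr hγ h3γ hζ hℓ h3ℓ hω9 hω hκ9 hκ hu h3u h3u2 hcert
        hq1 hqj

/-! ### §4 The uniform deep checker (`v₃(e) = K ≥ 2`), `y`-free -/

/-- **`y`-free uniform deep REG3CERT certificate** (twin of `certNonsplit_of_uniformCert`): `H` as there with `b` replaced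
by `β (mod 3^{N+1})` in the `λ`-congruence (a quartic in `b`, transported along `3^{N+1} ∣ b − β`), plus `IsSquare (P² + 4R)`,
`3^{N+1} ∣ β² + Pβ − R`, `3 ∤ 2β + P` and the `y`-free reduction test (`e = 3ᴷe'`). Per curve; nothing class-wide.
[cite: SteinWuthrich2013, §4.2] [cite: SilvermanAEC2009, VII.3.4] -/
theorem exists_certNonsplit_of_uniformCert_yfree (W : WeierstrassCurve ℚ) {a₁ a₂ a₃ a₄ a₆ : ℤ}
    (hW : W = ⟨a₁, a₂, a₃, a₄, a₆⟩) [W.IsElliptic] [W.IsGloballyMinimal] {a β c4 c6 D Γ lam ups : ℤ} {e' K n δ N m : ℕ}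
    (H : c4 = (a₁ ^ 2 + 4 * a₂) ^ 2 - 24 * (2 * a₄ + a₁ * a₃) ∧
      c6 = -(a₁ ^ 2 + 4 * a₂) ^ 3 + 36 * (a₁ ^ 2 + 4 * a₂) * (2 * a₄ + a₁ * a₃) - 216 * (a₃ ^ 2 + 4 * a₆) ∧
      D = -(a₁ ^ 2 + 4 * a₂) ^ 2 * (a₁ ^ 2 * a₆ + 4 * a₂ * a₆ - a₁ * a₃ * a₄ + a₂ * a₃ ^ 2 - a₄ ^ 2) -
        8 * (2 * a₄ + a₁ * a₃) ^ 3 - 27 * (a₃ ^ 2 + 4 * a₆) ^ 2 +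
        9 * (a₁ ^ 2 + 4 * a₂) * (2 * a₄ + a₁ * a₃) * (a₃ ^ 2 + 4 * a₆) ∧
      ¬ (3 : ℤ) ∣ c4 ∧ ¬ (3 : ℤ) ∣ c6 ∧ (3 : ℤ) ^ δ ∣ D ∧ 1 ≤ δ ∧ 2 ≤ K ∧ ¬ (3 : ℤ) ∣ e' ∧ ¬ (3 : ℤ) ∣ β ∧
      Nat.Coprime a.natAbs (3 ^ K * e') ∧
      IsSquare ((a₁ * a * (3 ^ K * e' : ℕ) + a₃ * (3 ^ K * e' : ℕ) ^ 3) ^ 2 +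
        4 * (a ^ 3 + a₂ * a ^ 2 * (3 ^ K * e' : ℕ) ^ 2 + a₄ * a * (3 ^ K * e' : ℕ) ^ 4 + a₆ * (3 ^ K * e' : ℕ) ^ 6)) ∧
      (3 : ℤ) ^ (N + 1) ∣ β ^ 2 + (a₁ * a * (3 ^ K * e' : ℕ) + a₃ * (3 ^ K * e' : ℕ) ^ 3) * β -
        (a ^ 3 + a₂ * a ^ 2 * (3 ^ K * e' : ℕ) ^ 2 + a₄ * a * (3 ^ K * e' : ℕ) ^ 4 + a₆ * (3 ^ K * e' : ℕ) ^ 6) ∧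
      ¬ (3 : ℤ) ∣ 2 * β + (a₁ * a * (3 ^ K * e' : ℕ) + a₃ * (3 ^ K * e' : ℕ) ^ 3) ∧
      Int.gcd ((a₁ * a * (3 ^ K * e' : ℕ) + a₃ * (3 ^ K * e' : ℕ) ^ 3) ^ 2 +
          4 * (a ^ 3 + a₂ * a ^ 2 * (3 ^ K * e' : ℕ) ^ 2 + a₄ * a * (3 ^ K * e' : ℕ) ^ 4 + a₆ * (3 ^ K * e' : ℕ) ^ 6))
        (a₁ * (3 ^ K * e' : ℕ) * (a₁ * a * (3 ^ K * e' : ℕ) + a₃ * (3 ^ K * e' : ℕ) ^ 3) +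
          2 * (3 * a ^ 2 + 2 * a₂ * a * (3 ^ K * e' : ℕ) ^ 2 + a₄ * (3 ^ K * e' : ℕ) ^ 4)) ∣ (2 * (3 ^ K * e')) ^ n ∧
      (¬ (2 : ℤ) ∣ a₁ * a * (3 ^ K * e' : ℕ) + a₃ * (3 ^ K * e' : ℕ) ^ 3 ∨
        ¬ (2 : ℤ) ∣ a₁ * (3 ^ K * e' : ℕ) *
            (a ^ 3 + a₂ * a ^ 2 * (3 ^ K * e' : ℕ) ^ 2 + a₄ * a * (3 ^ K * e' : ℕ) ^ 4 + a₆ * (3 ^ K * e' : ℕ) ^ 6) -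
          (3 * a ^ 2 + 2 * a₂ * a * (3 ^ K * e' : ℕ) ^ 2 + a₄ * (3 ^ K * e' : ℕ) ^ 4)) ∧
      ¬ (3 : ℤ) ∣ Γ ∧ ¬ (3 : ℤ) ∣ lam ∧ ¬ (3 : ℤ) ∣ ups ∧
      m ≤ 2 * δ + 1 ∧ 1 ≤ m ∧ m ≤ N ∧ 1 ≤ N ∧ N ≤ 4 * K ∧ N + 2 ≤ 6 * K ∧ N + 1 ≤ m + 2 * K ∧ N ≤ 2 * δ + 2 * K ∧
      N + 1 ≤ δ + 4 * K ∧
      (3 : ℤ) ^ m ∣ (c4 ^ 3 - 504 * D) * c4 + Γ * c6 * (c4 ^ 3 + 240 * D) ∧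
      (3 : ℤ) ^ (N + 1) ∣ -12 * (a * e') * β ^ 3 + 6 * a₁ * 3 ^ K * (a * e') ^ 2 * β ^ 2 -
        4 * (a₁ ^ 2 + a₂) * 3 ^ (2 * K) * (a * e') ^ 3 * β +
        3 * (a₁ ^ 3 + 2 * a₁ * a₂ + 2 * a₃) * 3 ^ (3 * K) * (a * e') ^ 4 - 12 * lam * β ^ 4 ∧
      (3 : ℤ) ^ (N + 2) ∣ lam ^ 2 * (360 * Γ ^ 2 + 30 * 3 ^ (2 * K) * lam ^ 2 * Γ + 3 ^ (4 * K) * lam ^ 4) *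
        (c4 ^ 3 * Γ - 2 * 3 ^ (2 * K) * D * lam ^ 2) - 360 * Γ ^ 3 * c4 ^ 3 * ups ∧
      ¬ (3 : ℤ) ^ N ∣ ups ^ 2 - (e' : ℤ) ^ 4)
    {x : ℚ} (hx : x = a / ((3 ^ K * e' : ℕ) : ℚ) ^ 2) :
    ∃ y : ℚ, W.toAffine.Equation x y ∧ ∀ h : W.toAffine.Nonsingular x y, RegMult.CertNonsplit W 3 (.some x y h) 1 := by
  obtain ⟨hc4, hc6, hD, h3c4, h3c6, hδ, hδ1, hK, h3e', h3β, hcop, hsq, hβ, h3P, hgcd, h2, h3Γ, h3lam, h3ups, hmδ, hm1, hmN,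
    hN1, hNK, hN6K, hm, hPa, hPb, hΓ, hlamβ, hups, hcert⟩ := H
  have he'0 : e' ≠ 0 := by rintro rfl; exact h3e' (by simp)
  have he0 : (3 ^ K * e' : ℕ) ≠ 0 := by positivity
  have h3e : 3 ∣ 3 ^ K * e' := dvd_mul_of_dvd_left (dvd_pow_self 3 (by omega)) e'
  obtain ⟨b, hb, hbβ⟩ := exists_root_dvd_sub_of_isSquare hsq hβ h3P
  have h3b : ¬ (3 : ℤ) ∣ b := not_three_dvd_of_dvd_sub (by omega) hbβ h3β
  -- transport the quartic `λ`-congruence from `β` to `b`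
  have hlam : (3 : ℤ) ^ (N + 1) ∣ -12 * (a * e') * b ^ 3 + 6 * a₁ * 3 ^ K * (a * e') ^ 2 * b ^ 2 -
      4 * (a₁ ^ 2 + a₂) * 3 ^ (2 * K) * (a * e') ^ 3 * b +
      3 * (a₁ ^ 3 + 2 * a₁ * a₂ + 2 * a₃) * 3 ^ (3 * K) * (a * e') ^ 4 - 12 * lam * b ^ 4 := by
    have hid : -12 * (a * e') * b ^ 3 + 6 * a₁ * 3 ^ K * (a * e') ^ 2 * b ^ 2 -
        4 * (a₁ ^ 2 + a₂) * 3 ^ (2 * K) * (a * e') ^ 3 * b +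
        3 * (a₁ ^ 3 + 2 * a₁ * a₂ + 2 * a₃) * 3 ^ (3 * K) * (a * e') ^ 4 - 12 * lam * b ^ 4 =
        (-12 * (a * e') * β ^ 3 + 6 * a₁ * 3 ^ K * (a * e') ^ 2 * β ^ 2 -
          4 * (a₁ ^ 2 + a₂) * 3 ^ (2 * K) * (a * e') ^ 3 * β +
          3 * (a₁ ^ 3 + 2 * a₁ * a₂ + 2 * a₃) * 3 ^ (3 * K) * (a * e') ^ 4 - 12 * lam * β ^ 4) +
        (b - β) * (-12 * (a * e') * (b ^ 2 + b * β + β ^ 2) + 6 * a₁ * 3 ^ K * (a * e') ^ 2 * (b + β) -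
          4 * (a₁ ^ 2 + a₂) * 3 ^ (2 * K) * (a * e') ^ 3 - 12 * lam * (b ^ 3 + b ^ 2 * β + b * β ^ 2 + β ^ 3)) := by
      ring
    rw [hid]; exact dvd_add hlamβ (hbβ.mul_right _)
  set y : ℚ := (b : ℚ) / ((3 ^ K * e' : ℕ) : ℚ) ^ 3 with hy
  refine ⟨y, ?_, fun h => ?_⟩
  · rw [hx, hy]; exact equation_of_intRoot W hW he0 hb
  · refine ⟨?_, fun q _ hq1 hqj => ?_⟩
    · rw [one_smul]
      exact isAdmissible_of_yfree W hW he0 h3e hcop hb hgcd h2 hx hy h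
    · rw [one_smul]
      exact heightFourOneCoord_ne_zero_of_uniformCert W (baseChange_a₁_eq W hW) (baseChange_a₂_eq W hW)
        (baseChange_a₃_eq W hW) (baseChange_c₄_eq W hW hc4) (baseChange_c₆_eq W hW hc6) h3c4 h3c6
        (ratCast_j_inv_eq W hW hc4 hD) hδ hδ1 hK h3e' h3b hcop hx hy h3Γ h3lam h3ups hmδ hm1 hmN hN1 hNK hN6K hm hPa hPb
        hΓ hlam hups hcert hq1 hqj

end Summit.BirchSwinnertonDyer.Rank1Residual.X11b.RegMult.KernelCert
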